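import Summits.KontsevichZagierPeriods.KontsevichZagierPeriods.Theorems.LinRedNormalFormArrangementNormalFormStubRebaseSimpleZeroTwoReduce

/-!
# Stub `stub_rebaseSimpleZeroTwo`, assembly (crux `ArrangementNormalForm`, line `janus-bands`) — part `TwoInterval`

One more normalisation of the different-slope hypothesis of `rebaseSimpleZeroTwo_of_different'`:
the base cell of a clean nest `A(y) < tᵢ < tⱼ < B(y)` with non-empty fibres over a bounded domain
may be taken to be a LITERAL rational interval `{l < y < u}` (`l < u`), i.e. the two-row cell
`![RebaseZero.mk 1 (-l), RebaseZero.mk (-1) u]`: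
* `RebaseNest.cell_eq_Ioo` — a non-empty base cell `{y | ∀ j, 0 < αⱼ y + βⱼ}` (rational rows)
  bounded in absolute value is a rational open interval (largest lower row, smallest upper row);
* `RebaseNest.nest_cell_bound` — the base cell of a clean nest with non-empty fibres is bounded
  as soon as the domain is (it is the projection of the domain);
* `RebaseNest.nest_interval` — rewrite the domain on the two interval rows (or it is empty);
* `RebaseNest.hdiff₀_of_interval` — the normalised hypothesis `HDiff₀` of
  `rebaseSimpleZeroTwo_of_normal'` from its interval form `HDiff₁` (pole side becomes `r ≤ l` or
  `u ≤ r`);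
* registered `rebaseSimpleZeroTwo_of_intervalGGset` (literal binders) and the stub-format closures
  `rebaseSimpleZeroTwo_of_interval'` / `rebaseSimpleZeroTwo_of_intervalWide'`.

References: M. Kontsevich, D. Zagier, *Periods* (2001), §1.2, rules (1a), (2).
-/

noncomputable section

open Set MeasureTheory MvPolynomial
open Literature.NumberTheory.Transcendental Literature.ModelTheory.ExponentialFields

namespace Summit.KontsevichZagierPeriods.ArrangementNormalForm.JanusBands

namespace RebaseNest

open SeparatePos RebasePos RebaseZero

variable {S : Set KZ.FormalRep} {m m' : ℕ} {i j : Fin 2}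

/-! ### Rational row cells are rational intervals -/

/-- A row of positive slope is a lower bound. [folklore] -/
theorem ev_pos_iff_of_pos {c : Cf} (hc : 0 < c.1 (Fin.last 0)) (y : ℝ) :
    0 < ev c y ↔ ((-c.2 / c.1 (Fin.last 0) : ℚ) : ℝ) < y := by
  have hα : (0 : ℝ) < c.1 (Fin.last 0) := by exact_mod_cast hc
  rw [ev, Rat.cast_div, Rat.cast_neg, div_lt_iff₀ hα]
  constructor <;> intro h <;> nlinarith

/-- A row of negative slope is an upper bound. [folklore] -/
theorem ev_pos_iff_of_neg {c : Cf} (hc : c.1 (Fin.last 0) < 0) (y : ℝ) :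
    0 < ev c y ↔ y < ((-c.2 / c.1 (Fin.last 0) : ℚ) : ℝ) := by
  have hα : (c.1 (Fin.last 0) : ℝ) < 0 := by exact_mod_cast hc
  rw [ev, Rat.cast_div, Rat.cast_neg, lt_div_iff_of_neg hα]
  constructor <;> intro h <;> nlinarith

/-- **A bounded non-empty rational row cell is a rational open interval.** [folklore] -/
theorem cell_eq_Ioo (M : Fin m' → Cf) {y₀ : ℝ} (hy₀ : y₀ ∈ cell M) {R : ℝ} (hR : ∀ y ∈ cell M, |y| ≤ R) :
    ∃ l u : ℚ, l < u ∧ ∀ y : ℝ, y ∈ cell M ↔ (l : ℝ) < y ∧ y < (u : ℝ) := by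
  classical
  have hR₀ : |y₀| ≤ R := hR y₀ hy₀
  -- the lower rows and the upper rows
  set P : Finset (Fin m') := Finset.univ.filter fun r => 0 < (M r).1 (Fin.last 0) with hP
  set N : Finset (Fin m') := Finset.univ.filter fun r => (M r).1 (Fin.last 0) < 0 with hN
  set g : Fin m' → ℚ := fun r => -(M r).2 / (M r).1 (Fin.last 0) with hg
  -- both are non-empty, since the cell is bounded
  have hPne : P.Nonempty := by
    by_contra h
    rw [Finset.not_nonempty_iff_eq_empty] at h
    have hmem : (-(R + 1) : ℝ) ∈ cell M := fun r => by
      have hr : ¬ 0 < (M r).1 (Fin.last 0) := fun hr => by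
        have : r ∈ P := by rw [hP, Finset.mem_filter]; exact ⟨Finset.mem_univ r, hr⟩
        rw [h] at this; exact absurd this (Finset.notMem_empty r)
      have hle : ((M r).1 (Fin.last 0) : ℝ) ≤ 0 := by exact_mod_cast not_lt.1 hr
      have h0 := hy₀ r
      rw [ev] at h0 ⊢
      have hy : -(R + 1) ≤ y₀ := by linarith [neg_abs_le y₀]
      nlinarith
    have := hR _ hmem
    rw [abs_neg, abs_of_nonneg (by linarith [abs_nonneg y₀])] at this
    linarith
  have hNne : N.Nonempty := by
    by_contra h
    rw [Finset.not_nonempty_iff_eq_empty] at h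
    have hmem : (R + 1 : ℝ) ∈ cell M := fun r => by
      have hr : ¬ (M r).1 (Fin.last 0) < 0 := fun hr => by
        have : r ∈ N := by rw [hN, Finset.mem_filter]; exact ⟨Finset.mem_univ r, hr⟩
        rw [h] at this; exact absurd this (Finset.notMem_empty r)
      have hle : (0 : ℝ) ≤ (M r).1 (Fin.last 0) := by exact_mod_cast not_lt.1 hr
      have h0 := hy₀ r
      rw [ev] at h0 ⊢
      have hy : y₀ ≤ R + 1 := by linarith [le_abs_self y₀]
      nlinarith
    have := hR _ hmem
    rw [abs_of_nonneg (by linarith [abs_nonneg y₀])] at this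
    linarith
  obtain ⟨r₁, hr₁, hmax⟩ := P.exists_max_image g hPne
  obtain ⟨r₂, hr₂, hmin⟩ := N.exists_min_image g hNne
  have hα₁ : 0 < (M r₁).1 (Fin.last 0) := by rw [hP, Finset.mem_filter] at hr₁; exact hr₁.2
  have hα₂ : (M r₂).1 (Fin.last 0) < 0 := by rw [hN, Finset.mem_filter] at hr₂; exact hr₂.2
  have key : ∀ y : ℝ, y ∈ cell M ↔ (g r₁ : ℝ) < y ∧ y < (g r₂ : ℝ) := fun y => by
    constructor
    · intro hy
      exact ⟨(ev_pos_iff_of_pos hα₁ y).1 (hy r₁), (ev_pos_iff_of_neg hα₂ y).1 (hy r₂)⟩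
    · rintro ⟨h1, h2⟩ r
      rcases lt_trichotomy ((M r).1 (Fin.last 0)) 0 with hr | hr | hr
      · have hrN : r ∈ N := by rw [hN, Finset.mem_filter]; exact ⟨Finset.mem_univ r, hr⟩
        have hle : (g r₂ : ℝ) ≤ g r := by exact_mod_cast hmin r hrN
        exact (ev_pos_iff_of_neg hr y).2 (h2.trans_le hle)
      · have h0 := hy₀ r
        rw [ev, hr, Rat.cast_zero, zero_mul, zero_add] at h0 ⊢
        exact h0
      · have hrP : r ∈ P := by rw [hP, Finset.mem_filter]; exact ⟨Finset.mem_univ r, hr⟩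
        have hle : (g r : ℝ) ≤ g r₁ := by exact_mod_cast hmax r hrP
        exact (ev_pos_iff_of_pos hr y).2 (hle.trans_lt h1)
  refine ⟨g r₁, g r₂, ?_, key⟩
  obtain ⟨h1, h2⟩ := (key y₀).1 hy₀
  exact_mod_cast h1.trans h2

/-- Membership in the two-row interval cell `{l < y < u}`. [folklore] -/
theorem mem_cell_Ioo (l u : ℚ) (y : ℝ) :
    y ∈ cell ![RebaseZero.mk 1 (-l), RebaseZero.mk (-1) u] ↔ (l : ℝ) < y ∧ y < (u : ℝ) := by
  simp only [cell, mem_setOf_eq, Fin.forall_fin_two, Matrix.cons_val_zero, Matrix.cons_val_one, ev_mk]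
  push_cast
  constructor <;> rintro ⟨h1, h2⟩ <;> constructor <;> linarith

/-! ### The interval normalisation -/

/-- **The base cell of a clean nest with non-empty fibres is bounded** as soon as the domain is:
it is the projection of the domain (lift `y` to the point with the fibres at one and two thirds
of `(A, B)`). [folklore] -/
theorem nest_cell_bound (hij : i ≠ j) (A Bd : Cf) (s : KZ.IntegralRep (0 + 1 + 2)) (M : Fin m' → Cf)
    (hbd : Bornology.IsBounded s.domain) (hdom : s.domain = gDom 0 2 m' M (nlo i A) (nhi j Bd))
    (hAB : ∀ y ∈ cell M, ev A y < ev Bd y) : ∃ R : ℝ, ∀ y ∈ cell M, |y| ≤ R := by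
  obtain ⟨R, hR⟩ := hbd.exists_norm_le
  refine ⟨R, fun y hy => ?_⟩
  have hlt := hAB y hy
  set z : Fin (0 + 1 + 2) → ℝ := Function.update (Function.update (fun _ => y) (tIdx i)
    ((2 * ev A y + ev Bd y) / 3)) (tIdx j) ((ev A y + 2 * ev Bd y) / 3) with hzdef
  have hyv : yv z = y := by
    simp only [yv, hzdef, Function.update_of_ne (yIdx_ne_tIdx j), Function.update_of_ne (yIdx_ne_tIdx i)]
  have hti : tv z i = (2 * ev A y + ev Bd y) / 3 := by
    simp only [tv, hzdef, Function.update_of_ne (tIdx_injective.ne hij), Function.update_self]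
  have htj : tv z j = (ev A y + 2 * ev Bd y) / 3 := by
    simp only [tv, hzdef, Function.update_self]
  have hz : z ∈ s.domain := by
    rw [hdom, mem_nDom hij, hyv, hti, htj]
    exact ⟨hy, by linarith, by linarith, by linarith⟩
  have h1 := norm_le_pi_norm z (yIdx 2)
  rw [Real.norm_eq_abs, show z (yIdx 2) = y from hyv] at h1
  exact h1.trans (hR _ hz)

/-- **Interval normalisation** (no move at all): to prove a clean nest `A < tᵢ < tⱼ < B` with
non-empty fibres over the base cell `cell M` `S`-good it suffices to prove `S`-good every clean nest
with the same bounds and integrand whose base cell is a LITERAL rational interval `{l < y < u}`,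
`l < u`, equal to `cell M` (if `cell M` is empty so is the domain; else it is a bounded rational
row cell, `nest_cell_bound`, hence a rational interval, `cell_eq_Ioo`). [folklore] -/
theorem nest_interval (f : (Fin (0 + 1 + 2) → ℝ) → ℝ) (hij : i ≠ j) (A Bd : Cf) (s : KZ.IntegralRep (0 + 1 + 2))
    (M : Fin m' → Cf) (hbd : Bornology.IsBounded s.domain) (hdom : s.domain = gDom 0 2 m' M (nlo i A) (nhi j Bd))
    (hint : EqOn s.integrand f s.domain) (hAB : ∀ y ∈ cell M, ev A y < ev Bd y)
    (H : ∀ (l u : ℚ) (r : KZ.IntegralRep (0 + 1 + 2)), l < u → (∀ y : ℝ, y ∈ cell M ↔ (l : ℝ) < y ∧ y < (u : ℝ)) →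
      Bornology.IsBounded r.domain →
      r.domain = gDom 0 2 2 ![RebaseZero.mk 1 (-l), RebaseZero.mk (-1) u] (nlo i A) (nhi j Bd) →
      EqOn r.integrand f r.domain → ∃ c ∈ AddSubgroup.closure S, KZ.of r - c ∈ KZ.relations) :
    ∃ c ∈ AddSubgroup.closure S, KZ.of s - c ∈ KZ.relations := by
  by_cases hne : ∃ y₀, y₀ ∈ cell M
  · obtain ⟨y₀, hy₀⟩ := hne
    obtain ⟨R, hR⟩ := nest_cell_bound hij A Bd s M hbd hdom hAB
    obtain ⟨l, u, hlu, hcell⟩ := cell_eq_Ioo M hy₀ hR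
    refine H l u s hlu hcell hbd ?_ hint
    rw [hdom]
    ext z
    rw [mem_nDom hij, mem_nDom hij, hcell, mem_cell_Ioo]
  · push Not at hne
    exact goodS_of_dom_empty s fun z hz => hne (yv z) (by rw [hdom, mem_nDom hij] at hz; exact hz.1)

/-- A point strictly to the left of every point of a non-empty interval is at most its left end;
symmetrically on the right. [folklore] -/
theorem pole_side_Ioo {l u ρ : ℚ} (hlu : l < u)
    (h : (∀ y : ℝ, (l : ℝ) < y ∧ y < (u : ℝ) → (ρ : ℝ) < y) ∨ (∀ y : ℝ, (l : ℝ) < y ∧ y < (u : ℝ) → y < (ρ : ℝ))) :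
    ρ ≤ l ∨ u ≤ ρ := by
  have hlu' : (l : ℝ) < u := by exact_mod_cast hlu
  rcases h with h | h
  · refine Or.inl (not_lt.1 fun hl => ?_)
    have hl' : (l : ℝ) < ρ := by exact_mod_cast hl
    have := h (((l : ℝ) + min (ρ : ℝ) u) / 2)
      ⟨by have := lt_min hl' hlu'; linarith, by have := min_le_right (ρ : ℝ) u; linarith⟩
    have := min_le_left (ρ : ℝ) u
    linarith
  · refine Or.inr (not_lt.1 fun hu => ?_)
    have hu' : (ρ : ℝ) < u := by exact_mod_cast hu
    have := h ((max (ρ : ℝ) l + u) / 2)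
      ⟨by have := le_max_right (ρ : ℝ) l; linarith, by have := max_lt hu' hlu'; linarith⟩
    have := le_max_left (ρ : ℝ) l
    linarith

/-- **The normalised different-slope hypothesis from its interval form.** For a target set `S`:
if every clean nest `A(y) < tᵢ < tⱼ < B(y)` over a LITERAL rational interval `{l < y < u}` (`l < u`)
with a literal `GS 0 2` integrand, inner letter constant, outer letter of non-zero `y`-slope,
non-empty fibres over the whole interval and base pole `r = ℓ₂.2` outside the open interval
(`r ≤ l` or `u ≤ r`) is `S`-good (`hD₁`), then the hypothesis `HDiff₀` of
`rebaseSimpleZeroTwo_of_normal'` with target `S` holds (`nest_interval`, `pole_side_Ioo`).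
[Kontsevich–Zagier 2001, §1.2, rule (1a)] -/
theorem hdiff₀_of_interval
    (hD₁ : ∀ (m : ℕ) (s : KZ.IntegralRep (0 + 1 + 2)) (L : Fin m → (Fin 0 → ℚ) × ℚ) (e : Fin m → ℕ)
      (p : MvPolynomial (Fin 0) ℚ) (ℓ₁ ℓ₂ : (Fin 0 → ℚ) × ℚ) (a : Fin 2 → Option ((Fin (0 + 1) → ℚ) × ℚ))
      (lo hi : Fin 2 → Fin 2 ⊕ ((Fin (0 + 1) → ℚ) × ℚ)) (i j : Fin 2) (A B ci cj : (Fin (0 + 1) → ℚ) × ℚ) (l u : ℚ),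
      i ≠ j → lo i = Sum.inr A → hi i = Sum.inl j → lo j = Sum.inl i → hi j = Sum.inr B →
      a i = some ci → a j = some cj → ci.1 (Fin.last 0) = 0 → cj.1 (Fin.last 0) ≠ 0 → l < u →
      (∀ y : ℝ, (l : ℝ) < y → y < (u : ℝ) → ev A y < ev B y) → (ℓ₂.2 ≤ l ∨ u ≤ ℓ₂.2) →
      Bornology.IsBounded s.domain →
      s.domain = gDom 0 2 2 ![RebaseZero.mk 1 (-l), RebaseZero.mk (-1) u] lo hi →
      EqOn s.integrand (glit 0 2 p L e ℓ₁ ℓ₂ 0 1 a) s.domain →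
      ∃ c ∈ AddSubgroup.closure S, KZ.of s - c ∈ KZ.relations)
    (m m' : ℕ) (s : KZ.IntegralRep (0 + 1 + 2)) (M : Fin m' → Cf) (L : Fin m → (Fin 0 → ℚ) × ℚ)
    (e : Fin m → ℕ) (p : MvPolynomial (Fin 0) ℚ) (ℓ₁ ℓ₂ : (Fin 0 → ℚ) × ℚ) (a : Fin 2 → Option Cf)
    (lo hi : Fin 2 → Fin 2 ⊕ Cf) (i j : Fin 2) (A B ci cj : Cf) (hij : i ≠ j) (hloi : lo i = Sum.inr A)
    (hhii : hi i = Sum.inl j) (hloj : lo j = Sum.inl i) (hhij : hi j = Sum.inr B) (hai : a i = some ci)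
    (haj : a j = some cj) (hci : ci.1 (Fin.last 0) = 0) (hcj : cj.1 (Fin.last 0) ≠ 0)
    (hAB : ∀ y ∈ cell M, ev A y < ev B y)
    (hside : (∀ y ∈ cell M, (ℓ₂.2 : ℝ) < y) ∨ (∀ y ∈ cell M, y < (ℓ₂.2 : ℝ)))
    (hbd : Bornology.IsBounded s.domain) (hdom : s.domain = gDom 0 2 m' M lo hi)
    (hint : EqOn s.integrand (glit 0 2 p L e ℓ₁ ℓ₂ 0 1 a) s.domain) :
    ∃ c ∈ AddSubgroup.closure S, KZ.of s - c ∈ KZ.relations := by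
  obtain ⟨hlo, hhi⟩ := eq_nlo_nhi hij hloi hhii hloj hhij
  subst hlo hhi
  refine nest_interval _ hij A B s M hbd hdom hint hAB fun l u r hlu hcell hb hd hi' => ?_
  refine hD₁ m r L e p ℓ₁ ℓ₂ a _ _ i j A B ci cj l u hij (nlo_self i A) (nhi_of_ne hij B) (nlo_of_ne hij A)
    (nhi_self j B) hai haj hci hcj hlu (fun y h1 h2 => hAB y ((hcell y).2 ⟨h1, h2⟩)) (pole_side_Ioo hlu ?_) hb hd hi'
  exact hside.imp (fun h y hy => h y ((hcell y).2 hy)) fun h y hy => h y ((hcell y).2 hy)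

end RebaseNest

/-- **The two-fibre rebase on the literal class, conditionally on the INTERVAL form `HDiff₁` of the
different-slope hypothesis** (registered part of `stub_rebaseSimpleZeroTwo`, line `janus-bands`,
literal binders). A representation with a literal `GS 0 2` datum (`n₂ = 1`, hence `n₁ = 0`) is
congruent modulo `KZ.relations` to a `ℤ`-combination of elements of the rebased literal class
`SeparatePos.GGset 0 2 2`, PROVIDED so is every clean nest `A(y) < tᵢ < tⱼ < B(y)` over a literal
rational interval `{l < y < u}` (`l < u`; rows `![RebaseZero.mk 1 (-l), RebaseZero.mk (-1) u]`)
whose inner letter is constant, whose outer letter has non-zero `y`-slope, whose fibres are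
non-empty over the whole interval and whose base pole `ℓ₂.2` lies outside the open interval.
Proof: `rebaseSimpleZeroTwo_of_normalGGset` with `RebaseNest.hdiff₀_of_interval`.
[Kontsevich–Zagier 2001, §1.2, rules (1a), (2)] -/
theorem rebaseSimpleZeroTwo_of_intervalGGset (HDiff₁ : ∀ (m : ℕ) (s : KZ.IntegralRep (0 + 1 + 2)) (L : Fin m → (Fin 0 → ℚ) × ℚ) (e : Fin m → ℕ) (p : MvPolynomial (Fin 0) ℚ) (ℓ₁ ℓ₂ : (Fin 0 → ℚ) × ℚ) (a : Fin 2 → Option ((Fin (0 + 1) → ℚ) × ℚ)) (lo hi : Fin 2 → Fin 2 ⊕ ((Fin (0 + 1) → ℚ) × ℚ)) (i j : Fin 2) (A B ci cj : (Fin (0 + 1) → ℚ) × ℚ) (l u : ℚ), i ≠ j → lo i = Sum.inr A → hi i = Sum.inl j → lo j = Sum.inl i → hi j = Sum.inr B → a i = some ci → a j = some cj → ci.1 (Fin.last 0) = 0 → cj.1 (Fin.last 0) ≠ 0 → l < u → (∀ y : ℝ, (l : ℝ) < y → y < (u : ℝ) → RebaseZero.ev A y < RebaseZero.ev B y) → (ℓ₂.2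 ≤ l ∨ u ≤ ℓ₂.2) → Bornology.IsBounded s.domain → s.domain = SeparatePos.gDom 0 2 2 ![RebaseZero.mk 1 (-l), RebaseZero.mk (-1) u] lo hi → EqOn s.integrand (RebasePos.glit 0 2 p L e ℓ₁ ℓ₂ 0 1 a) s.domain → ∃ c ∈ AddSubgroup.closure (SeparatePos.GGset 0 2 2), KZ.of s - c ∈ KZ.relations) (m m' n₁ n₂ : ℕ) (s : KZ.IntegralRep (0 + 1 + 2)) (M : Fin m' → (Fin (0 + 1) → ℚ) × ℚ) (L : Fin m → (Fin 0 → ℚ) × ℚ) (e : Fin m → ℕ) (p : MvPolynomial (Fin 0) ℚ) (ℓ₁ ℓ₂ : (Fin 0 → ℚ) × ℚ) (a : Fin 2 → Option ((Fin (0 + 1) → ℚ) × ℚ)) (lo hi : Fin 2 → Fin 2 ⊕ ((Fin (0 + 1) → ℚ) × ℚ)) (h12 : n₁ = 0 ∨ n₂ = 0) (hn : n₂ = 1) (hbd : Bornology.IsBounded s.domain) (hdom : s.domain = SeparatePos.gDom 0 2 m' M lo hi) (hint : EqOn s.integrand (RebasePos.glit 0 2 p L e ℓ₁ ℓ₂ n₁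 n₂ a) s.domain) : ∃ c ∈ AddSubgroup.closure (SeparatePos.GGset 0 2 2), KZ.of s - c ∈ KZ.relations :=
  rebaseSimpleZeroTwo_of_normalGGset (RebaseNest.hdiff₀_of_interval HDiff₁) m m' n₁ n₂ s M L e p ℓ₁ ℓ₂ a lo hi h12 hn
    hbd hdom hint

/-- **`stub_rebaseSimpleZeroTwo` conditionally on the INTERVAL form `HDiff₁` (NARROW target) of the
different-slope hypothesis** (line `janus-bands`): as `rebaseSimpleZeroTwo_of_normal'`, the clean
nests being moreover over literal rational intervals `{l < y < u}` with the base pole outside the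
open interval (`RebaseNest.hdiff₀_of_interval`). The defining equations of `JJ`, `JD` are not
needed. [Kontsevich–Zagier 2001, §1.2, rules (1a), (1b), (2)] -/
theorem rebaseSimpleZeroTwo_of_interval' (GS : ℕ → ℕ → Set KZ.FormalRep) (GG : ℕ → ℕ → ℕ → Set KZ.FormalRep) (hGS : ∀ b k, GS b k = {w : KZ.FormalRep | ∃ (m m' n₁ n₂ : ℕ) (s : KZ.IntegralRep (b + 1 + k)) (M : Fin m' → (Fin (b + 1) → ℚ) × ℚ) (L : Fin m → (Fin b → ℚ) × ℚ) (e : Fin m → ℕ) (p : MvPolynomial (Fin b) ℚ) (ℓ₁ ℓ₂ : (Fin b → ℚ) × ℚ) (a : Fin k → Option ((Fin (b + 1) → ℚ) × ℚ)) (lo hi : Fin k → Fin k ⊕ ((Fin (b + 1) → ℚ) × ℚ)), (n₁ = 0 ∨ n₂ = 0) ∧ n₂ = 1 ∧ Bornology.IsBounded s.domain ∧ s.domain = {z | (∀ j, 0 < ∑ i, ((M j).1 i : ℝ) * z (Fin.castAdd k i) + ((M j).2 : ℝ)) ∧ ∀ i, Sum.elim (fun j => z (Fin.natAdd (b + 1)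 j)) (fun c => ∑ i', (c.1 i' : ℝ) * z (Fin.castAdd k i') + (c.2 : ℝ)) (lo i) < z (Fin.natAdd (b + 1) i) ∧ z (Fin.natAdd (b + 1) i) < Sum.elim (fun j => z (Fin.natAdd (b + 1) j)) (fun c => ∑ i', (c.1 i' : ℝ) * z (Fin.castAdd k i') + (c.2 : ℝ)) (hi i)} ∧ EqOn s.integrand (fun z => MvPolynomial.aeval (fun i => z (Fin.castAdd k (Fin.castSucc i))) p / (∏ j, (∑ i, ((L j).1 i : ℝ) * z (Fin.castAdd k (Fin.castSucc i)) + ((L j).2 : ℝ)) ^ e j) * ((z (Fin.castAdd k (Fin.last b)) - (∑ i, (ℓ₁.1 i : ℝ) * z (Fin.castAdd k (Fin.castSucc i)) + (ℓ₁.2 : ℝ))) ^ n₁ / (z (Fin.castAdd k (Fin.last b)) - (∑ i, (ℓ₂.1 i : ℝ) * z (Fin.castAdd k (Fin.castSucc i)) + (ℓ₂.2 : ℝ))) ^ n₂) * ∏ i, (a i).elim 1 (fun c => 1 / (z (Fin.natAdd (b + 1) i) - (∑ i', (c.1 i' : ℝ) * z (Fin.castAdd k i') + (c.2 : ℝ)))))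 s.domain ∧ w = KZ.of s}) (hGG : ∀ b σ k, GG b σ k = {w : KZ.FormalRep | ∃ (m m' n₁ n₂ : ℕ) (s : KZ.IntegralRep (b + 1 + k)) (M : Fin m' → (Fin (b + 1) → ℚ) × ℚ) (L : Fin m → (Fin b → ℚ) × ℚ) (e : Fin m → ℕ) (p : MvPolynomial (Fin b) ℚ) (ℓ₁ ℓ₂ : (Fin b → ℚ) × ℚ) (a : Fin k → Option ((Fin (b + 1) → ℚ) × ℚ)) (lo hi : Fin k → Fin k ⊕ ((Fin (b + 1) → ℚ) × ℚ)), (n₁ = 0 ∨ n₂ = 0) ∧ (σ = 2 → (∀ i c, a i = some c → c.1 (Fin.last b) = 0) ∧ (∀ i c, (lo i = Sum.inr c ∨ hi i = Sum.inr c) → (c.1 (Fin.last b) = 0 ∨ c = (Pi.single (Fin.last b) 1, 0)))) ∧ Bornology.IsBounded s.domain ∧ s.domain = {z | (∀ j, 0 < ∑ i, ((M j).1 i : ℝ) * z (Fin.castAdd k i) + ((M j).2 : ℝ)) ∧ ∀ i, Sum.elim (fun j => z (Fin.natAdd (b + 1) j)) (fun c => ∑ i', (c.1 i' : ℝ) *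 z (Fin.castAdd k i') + (c.2 : ℝ)) (lo i) < z (Fin.natAdd (b + 1) i) ∧ z (Fin.natAdd (b + 1) i) < Sum.elim (fun j => z (Fin.natAdd (b + 1) j)) (fun c => ∑ i', (c.1 i' : ℝ) * z (Fin.castAdd k i') + (c.2 : ℝ)) (hi i)} ∧ EqOn s.integrand (fun z => MvPolynomial.aeval (fun i => z (Fin.castAdd k (Fin.castSucc i))) p / (∏ j, (∑ i, ((L j).1 i : ℝ) * z (Fin.castAdd k (Fin.castSucc i)) + ((L j).2 : ℝ)) ^ e j) * ((z (Fin.castAdd k (Fin.last b)) - (∑ i, (ℓ₁.1 i : ℝ) * z (Fin.castAdd k (Fin.castSucc i)) + (ℓ₁.2 : ℝ))) ^ n₁ / (z (Fin.castAdd k (Fin.last b)) - (∑ i, (ℓ₂.1 i : ℝ) * z (Fin.castAdd k (Fin.castSucc i)) + (ℓ₂.2 : ℝ))) ^ n₂) * ∏ i, (a i).elim 1 (fun c => 1 / (z (Fin.natAdd (b + 1) i) - (∑ i', (c.1 i' : ℝ) * z (Fin.castAdd k i') + (c.2 : ℝ))))) s.domain ∧ w = KZ.of s}) (JJ : ℕ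 → ℕ → Set KZ.FormalRep) (JD : ℕ → Set KZ.FormalRep) (hJJ : ∀ b k, JJ b k = {w : KZ.FormalRep | ∃ (m m' : ℕ) (s : KZ.IntegralRep (b + k)) (M : Fin m' → (Fin b → ℚ) × ℚ) (L : Fin m → (Fin b → ℚ) × ℚ) (e : Fin m → ℕ) (p : MvPolynomial (Fin b) ℚ) (a : Fin k → Option ((Fin b → ℚ) × ℚ)) (lo hi : Fin k → Fin k ⊕ ((Fin b → ℚ) × ℚ)), Bornology.IsBounded s.domain ∧ s.domain = {z | (∀ j, 0 < ∑ i, ((M j).1 i : ℝ) * z (Fin.castAdd k i) + ((M j).2 : ℝ)) ∧ ∀ i, Sum.elim (fun j => z (Fin.natAdd b j)) (fun c => ∑ i', (c.1 i' : ℝ) * z (Fin.castAdd k i') + (c.2 : ℝ)) (lo i) < z (Fin.natAdd b i) ∧ z (Fin.natAdd b i) < Sum.elim (fun j => z (Fin.natAdd b j)) (fun c => ∑ i', (c.1 i' : ℝ) * z (Fin.castAdd k i') + (c.2 : ℝ)) (hi i)} ∧ EqOn s.integrand (fun z => MvPolynomial.aeval (fun i => z (Fin.castAdd k i)) p / (∏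 j, (∑ i, ((L j).1 i : ℝ) * z (Fin.castAdd k i) + ((L j).2 : ℝ)) ^ e j) * ∏ i, (a i).elim 1 (fun c => 1 / (z (Fin.natAdd b i) - (∑ i', (c.1 i' : ℝ) * z (Fin.castAdd k i') + (c.2 : ℝ))))) s.domain ∧ w = KZ.of s}) (hJD : ∀ N, JD N = {w : KZ.FormalRep | ∃ b' k', b' + k' = N ∧ w ∈ JJ b' k'}) (HDiff₁ : ∀ (m : ℕ) (s : KZ.IntegralRep (0 + 1 + 2)) (L : Fin m → (Fin 0 → ℚ) × ℚ) (e : Fin m → ℕ) (p : MvPolynomial (Fin 0) ℚ) (ℓ₁ ℓ₂ : (Fin 0 → ℚ) × ℚ) (a : Fin 2 → Option ((Fin (0 + 1) → ℚ) × ℚ)) (lo hi : Fin 2 → Fin 2 ⊕ ((Fin (0 + 1) → ℚ) × ℚ)) (i j : Fin 2) (A B ci cj : (Fin (0 + 1) → ℚ) × ℚ) (l u : ℚ), i ≠ j → lo i = Sum.inr A → hi i = Sum.inl j → lo j = Sum.inl i → hi j = Sum.inr B → a i = some ci → a j = some cj → ci.1 (Fin.last 0) = 0 → cj.1 (Fin.last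 0) ≠ 0 → l < u → (∀ y : ℝ, (l : ℝ) < y → y < (u : ℝ) → RebaseZero.ev A y < RebaseZero.ev B y) → (ℓ₂.2 ≤ l ∨ u ≤ ℓ₂.2) → Bornology.IsBounded s.domain → s.domain = SeparatePos.gDom 0 2 2 ![RebaseZero.mk 1 (-l), RebaseZero.mk (-1) u] lo hi → EqOn s.integrand (RebasePos.glit 0 2 p L e ℓ₁ ℓ₂ 0 1 a) s.domain → ∃ c ∈ AddSubgroup.closure (SeparatePos.GGset 0 2 2), KZ.of s - c ∈ KZ.relations) : ∀ x ∈ GS 0 2, ∃ c ∈ AddSubgroup.closure (GG 0 2 2 ∪ JJ 0 3 ∪ JD 2), x - c ∈ KZ.relations :=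
  rebaseSimpleZeroTwo_of_normal' GS GG hGS hGG JJ JD hJJ hJD (RebaseNest.hdiff₀_of_interval HDiff₁)

/-- **`stub_rebaseSimpleZeroTwo` conditionally on the INTERVAL form `HDiff₁` (WIDE target) of the
different-slope hypothesis** (line `janus-bands`): as `rebaseSimpleZeroTwo_of_normalWide'`, the
clean nests being moreover over literal rational intervals `{l < y < u}` with the base pole outside
the open interval (`RebaseNest.hdiff₀_of_interval`). The defining equations of `JJ`, `JD` are not
needed. [Kontsevich–Zagier 2001, §1.2, rules (1a), (1b), (2)] -/
theorem rebaseSimpleZeroTwo_of_intervalWide' (GS : ℕ → ℕ → Set KZ.FormalRep) (GG : ℕ → ℕ → ℕ → Set KZ.FormalRep) (hGS : ∀ b k, GS b k = {w : KZ.FormalRep | ∃ (m m' n₁ n₂ : ℕ) (s : KZ.IntegralRep (b + 1 + k)) (M : Fin m' → (Fin (b + 1) → ℚ) × ℚ) (L : Fin m → (Fin b → ℚ) × ℚ) (e : Fin m → ℕ) (p : MvPolynomial (Fin b) ℚ) (ℓ₁ ℓ₂ : (Fin b → ℚ) × ℚ) (a : Fin k → Option ((Fin (b + 1) → ℚ)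 × ℚ)) (lo hi : Fin k → Fin k ⊕ ((Fin (b + 1) → ℚ) × ℚ)), (n₁ = 0 ∨ n₂ = 0) ∧ n₂ = 1 ∧ Bornology.IsBounded s.domain ∧ s.domain = {z | (∀ j, 0 < ∑ i, ((M j).1 i : ℝ) * z (Fin.castAdd k i) + ((M j).2 : ℝ)) ∧ ∀ i, Sum.elim (fun j => z (Fin.natAdd (b + 1) j)) (fun c => ∑ i', (c.1 i' : ℝ) * z (Fin.castAdd k i') + (c.2 : ℝ)) (lo i) < z (Fin.natAdd (b + 1) i) ∧ z (Fin.natAdd (b + 1) i) < Sum.elim (fun j => z (Fin.natAdd (b + 1) j)) (fun c => ∑ i', (c.1 i' : ℝ) * z (Fin.castAdd k i') + (c.2 : ℝ)) (hi i)} ∧ EqOn s.integrand (fun z => MvPolynomial.aeval (fun i => z (Fin.castAdd k (Fin.castSucc i))) p / (∏ j, (∑ i, ((L j).1 i : ℝ) * z (Fin.castAdd k (Fin.castSucc i)) + ((L j).2 : ℝ)) ^ e j) * ((z (Fin.castAdd k (Fin.last b)) - (∑ i, (ℓ₁.1 i : ℝ) * z (Fin.castAdd k (Fin.castSucc i)) +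 (ℓ₁.2 : ℝ))) ^ n₁ / (z (Fin.castAdd k (Fin.last b)) - (∑ i, (ℓ₂.1 i : ℝ) * z (Fin.castAdd k (Fin.castSucc i)) + (ℓ₂.2 : ℝ))) ^ n₂) * ∏ i, (a i).elim 1 (fun c => 1 / (z (Fin.natAdd (b + 1) i) - (∑ i', (c.1 i' : ℝ) * z (Fin.castAdd k i') + (c.2 : ℝ))))) s.domain ∧ w = KZ.of s}) (hGG : ∀ b σ k, GG b σ k = {w : KZ.FormalRep | ∃ (m m' n₁ n₂ : ℕ) (s : KZ.IntegralRep (b + 1 + k)) (M : Fin m' → (Fin (b + 1) → ℚ) × ℚ) (L : Fin m → (Fin b → ℚ) × ℚ) (e : Fin m → ℕ) (p : MvPolynomial (Fin b) ℚ) (ℓ₁ ℓ₂ : (Fin b → ℚ) × ℚ) (a : Fin k → Option ((Fin (b + 1) → ℚ) × ℚ)) (lo hi : Fin k → Fin k ⊕ ((Fin (b + 1) → ℚ) × ℚ)), (n₁ = 0 ∨ n₂ = 0) ∧ (σ = 2 → (∀ i c, a i = some c → c.1 (Fin.last b) = 0) ∧ (∀ i c, (lo i = Sum.inr c ∨ hi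 i = Sum.inr c) → (c.1 (Fin.last b) = 0 ∨ c = (Pi.single (Fin.last b) 1, 0)))) ∧ Bornology.IsBounded s.domain ∧ s.domain = {z | (∀ j, 0 < ∑ i, ((M j).1 i : ℝ) * z (Fin.castAdd k i) + ((M j).2 : ℝ)) ∧ ∀ i, Sum.elim (fun j => z (Fin.natAdd (b + 1) j)) (fun c => ∑ i', (c.1 i' : ℝ) * z (Fin.castAdd k i') + (c.2 : ℝ)) (lo i) < z (Fin.natAdd (b + 1) i) ∧ z (Fin.natAdd (b + 1) i) < Sum.elim (fun j => z (Fin.natAdd (b + 1) j)) (fun c => ∑ i', (c.1 i' : ℝ) * z (Fin.castAdd k i') + (c.2 : ℝ)) (hi i)} ∧ EqOn s.integrand (fun z => MvPolynomial.aeval (fun i => z (Fin.castAdd k (Fin.castSucc i))) p / (∏ j, (∑ i, ((L j).1 i : ℝ) * z (Fin.castAdd k (Fin.castSucc i)) + ((L j).2 : ℝ)) ^ e j) * ((z (Fin.castAdd k (Fin.last b)) - (∑ i, (ℓ₁.1 i : ℝ) * z (Fin.castAdd k (Fin.castSucc i)) + (ℓ₁.2 : ℝ))) ^ n₁ / (z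 (Fin.castAdd k (Fin.last b)) - (∑ i, (ℓ₂.1 i : ℝ) * z (Fin.castAdd k (Fin.castSucc i)) + (ℓ₂.2 : ℝ))) ^ n₂) * ∏ i, (a i).elim 1 (fun c => 1 / (z (Fin.natAdd (b + 1) i) - (∑ i', (c.1 i' : ℝ) * z (Fin.castAdd k i') + (c.2 : ℝ))))) s.domain ∧ w = KZ.of s}) (JJ : ℕ → ℕ → Set KZ.FormalRep) (JD : ℕ → Set KZ.FormalRep) (hJJ : ∀ b k, JJ b k = {w : KZ.FormalRep | ∃ (m m' : ℕ) (s : KZ.IntegralRep (b + k)) (M : Fin m' → (Fin b → ℚ) × ℚ) (L : Fin m → (Fin b → ℚ) × ℚ) (e : Fin m → ℕ) (p : MvPolynomial (Fin b) ℚ) (a : Fin k → Option ((Fin b → ℚ) × ℚ)) (lo hi : Fin k → Fin k ⊕ ((Fin b → ℚ) × ℚ)), Bornology.IsBounded s.domain ∧ s.domain = {z | (∀ j, 0 < ∑ i, ((M j).1 i : ℝ) * z (Fin.castAdd k i) + ((M j).2 : ℝ)) ∧ ∀ i, Sum.elim (fun j => z (Fin.natAdd b j)) (fun c => ∑ i',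 (c.1 i' : ℝ) * z (Fin.castAdd k i') + (c.2 : ℝ)) (lo i) < z (Fin.natAdd b i) ∧ z (Fin.natAdd b i) < Sum.elim (fun j => z (Fin.natAdd b j)) (fun c => ∑ i', (c.1 i' : ℝ) * z (Fin.castAdd k i') + (c.2 : ℝ)) (hi i)} ∧ EqOn s.integrand (fun z => MvPolynomial.aeval (fun i => z (Fin.castAdd k i)) p / (∏ j, (∑ i, ((L j).1 i : ℝ) * z (Fin.castAdd k i) + ((L j).2 : ℝ)) ^ e j) * ∏ i, (a i).elim 1 (fun c => 1 / (z (Fin.natAdd b i) - (∑ i', (c.1 i' : ℝ) * z (Fin.castAdd k i') + (c.2 : ℝ))))) s.domain ∧ w = KZ.of s}) (hJD : ∀ N, JD N = {w : KZ.FormalRep | ∃ b' k', b' + k' = N ∧ w ∈ JJ b' k'}) (HDiff₁ : ∀ (m : ℕ) (s : KZ.IntegralRep (0 + 1 + 2)) (L : Fin m → (Fin 0 → ℚ) × ℚ) (e : Fin m → ℕ) (p : MvPolynomial (Fin 0) ℚ) (ℓ₁ ℓ₂ : (Fin 0 → ℚ) × ℚ) (a : Fin 2 → Option ((Fin (0 +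 1) → ℚ) × ℚ)) (lo hi : Fin 2 → Fin 2 ⊕ ((Fin (0 + 1) → ℚ) × ℚ)) (i j : Fin 2) (A B ci cj : (Fin (0 + 1) → ℚ) × ℚ) (l u : ℚ), i ≠ j → lo i = Sum.inr A → hi i = Sum.inl j → lo j = Sum.inl i → hi j = Sum.inr B → a i = some ci → a j = some cj → ci.1 (Fin.last 0) = 0 → cj.1 (Fin.last 0) ≠ 0 → l < u → (∀ y : ℝ, (l : ℝ) < y → y < (u : ℝ) → RebaseZero.ev A y < RebaseZero.ev B y) → (ℓ₂.2 ≤ l ∨ u ≤ ℓ₂.2) → Bornology.IsBounded s.domain → s.domain = SeparatePos.gDom 0 2 2 ![RebaseZero.mk 1 (-l), RebaseZero.mk (-1) u] lo hi → EqOn s.integrand (RebasePos.glit 0 2 p L e ℓ₁ ℓ₂ 0 1 a) s.domain → ∃ c ∈ AddSubgroup.closure (GG 0 2 2 ∪ JJ 0 3 ∪ JD 2), KZ.of s - c ∈ KZ.relations) : ∀ x ∈ GS 0 2, ∃ c ∈ AddSubgroup.closure (GG 0 2 2 ∪ JJ 0 3 ∪ JD 2), x - c ∈ KZ.relations :=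
  rebaseSimpleZeroTwo_of_normalWide' GS GG hGS hGG JJ JD hJJ hJD (RebaseNest.hdiff₀_of_interval HDiff₁)

end Summit.KontsevichZagierPeriods.ArrangementNormalForm.JanusBands
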